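import Mathlib
import Literature.Computability.Complexity.GateValueConsistency
import HarnessLib

/-!
# The exact linear-programming encoding of a straight-line circuit (Valiant 1977 / Yannakakis 1991)

Toolkit for the discharge of the named fact
`Literature.Computability.Complexity.hrubes_separation_rank_bound` (Hrubeš 2020, Thm. 3) in
`SeparationComplexityProofs.lean`. The one ingredient of Hrubeš's Proposition 7(i)
("`sep(f) ≤ O(C(f))`", credited there to Valiant [22] and Yannakakis [26]) is the standard fact
that the computation of a Boolean circuit is described EXACTLY by a linear program of size
linear in the circuit: with one real variable `y_j ∈ [0, 1]` per gate and, for every gate `j`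
(truth table `op`, argument wires `w_a`) and every corner `α ∈ {0,1}^{arity}`, the inequality

* `y_j ≥ 1 - gap_α`  if `op α = 1`,   `y_j ≤ gap_α`  if `op α = 0`,
  where `gap_α := ∑_a |w_a - α_a|` (written with the literals `t ↦ t`, `t ↦ 1 - t`),

every REAL solution `y` over a BOOLEAN input `x` equals the list of true gate values
(`CircuitLP.eq_trueVal_of_feasible`, induction along the program: at the corner `α` actually
presented by the arguments the gap is `0`, forcing `y_j ∈ {0, 1}` to the right value; at every
other corner the gap is `≥ 1` and the inequality is implied by `0 ≤ y ≤ 1`), and conversely the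
true gate values satisfy the system (`CircuitLP.slack_trueVal_nonneg`).

Phrased for the tree's straight-line programs (`GateList.vals/wireOf/WF`, `CircuitComposition.lean`;
cf. `GateValueConsistency.lean`, the Boolean version of the same exactness). For the Farkas step
downstream every constraint is also given in coefficient form, `cvec g ⬝ᵥ y + ivec g ⬝ᵥ ξ(x) + k0 g ≥ 0`
with `ξ(x) ∈ {0,1}^ι` the input as a real vector (`CircuitLP.slack`, `slack_corner` … `slack_out`);
indices (`CircuitLP.Idx`): corners `(j, α)`, the two box constraints of `j`, the output constraint
`value(out) ≥ 1` — `∑_j 2^{arity j} + 2L + 1 ≤ 6L + 1` of them over `B2` (`card_idx`, `card_idx_le`).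
References: P. Hrubeš, *On ε-sensitive monotone computations*, Comput. Complexity 29 (2020),
Prop. 7(i) [Hrubes2020]; M. Yannakakis, JCSS 43 (1991), §2 (the LP of a circuit). No new notion
is introduced: the definitions below are the bookkeeping of one proof.
-/

namespace Literature.Computability.Complexity

open Finset Matrix GateList

-- Grouping namespace `CircuitLP`: the LP encoding of a circuit (the object of Hrubeš 2020,
-- Prop. 7(i)).
namespace CircuitLP

variable {ι : Type*}

/-! ### Reals attached to bits and literals -/

/-- The real number `0`/`1` of a bit. [folklore] -/
def b2r : Bool → ℝ
  | true => 1
  | false => 0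

/-- `b2r true = 1`. [folklore] -/
@[simp] theorem b2r_true : b2r true = 1 := rfl

/-- `b2r false = 0`. [folklore] -/
@[simp] theorem b2r_false : b2r false = 0 := rfl

/-- `0 ≤ b2r b`. [folklore] -/
theorem b2r_nonneg (b : Bool) : 0 ≤ b2r b := by cases b <;> simp

/-- `b2r b ≤ 1`. [folklore] -/
theorem b2r_le_one (b : Bool) : b2r b ≤ 1 := by cases b <;> simp

/-- The input assignment as a real `0/1` vector `ξ(x)`. [folklore] -/
def ξ (x : ι → Bool) : ι → ℝ := fun i => b2r (x i)

/-- `ξ(x)_i = b2r (x i)` (definitional). [folklore] -/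
@[simp] theorem ξ_apply (x : ι → Bool) (i : ι) : ξ x i = b2r (x i) := rfl

/-- The literal of polarity `b` evaluated at `t`: `1 - t` for `b = 1`, `t` for `b = 0`
(on `[0,1]` this is the distance `|t - b|`). [folklore] -/
def lit : Bool → ℝ → ℝ
  | true, t => 1 - t
  | false, t => t

/-- Slope of the literal: `-1` for `b = 1`, `+1` for `b = 0`. [folklore] -/
def lsign : Bool → ℝ
  | true => -1
  | false => 1

/-- Offset of the literal: `1` for `b = 1`, `0` for `b = 0`. [folklore] -/
def loff : Bool → ℝ
  | true => 1
  | false => 0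

/-- The literal is affine: `lit b t = loff b + lsign b * t`. [folklore] -/
theorem lit_eq (b : Bool) (t : ℝ) : lit b t = loff b + lsign b * t := by
  cases b
  · simp only [lit, loff, lsign]; ring
  · simp only [lit, loff, lsign]; ring

/-- A literal vanishes at its own corner: `lit b b = 0`. [folklore] -/
@[simp] theorem lit_self (b : Bool) : lit b (b2r b) = 0 := by
  cases b
  · rfl
  · simp only [lit, b2r_true, sub_self]

/-- A literal is `1` at the opposite corner. [folklore] -/
theorem lit_of_ne {a b : Bool} (h : a ≠ b) : lit a (b2r b) = 1 := by
  cases a <;> cases b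
  · exact absurd rfl h
  · rfl
  · simp only [lit, b2r_false, sub_zero]
  · exact absurd rfl h

/-- A literal is non-negative on `[0, 1]`. [folklore] -/
theorem lit_nonneg (b : Bool) {t : ℝ} (h0 : 0 ≤ t) (h1 : t ≤ 1) : 0 ≤ lit b t := by
  cases b
  · simpa only [lit] using h0
  · simp only [lit]; linarith

/-- `|lsign b| ≤ 1`, in the form `lsign b * c ≤ |c|`. [folklore] -/
theorem lsign_mul_le_abs (b : Bool) (c : ℝ) : lsign b * c ≤ |c| := by
  cases b
  · simpa only [lsign, one_mul] using le_abs_self c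
  · simpa only [lsign, neg_mul, one_mul] using neg_le_abs c

/-- The sign attached to a truth value of a gate: `+1` (constraint `y ≥ 1 - gap`) for `1`,
`-1` (constraint `-y ≥ -gap`) for `0`. [folklore] -/
def sgn : Bool → ℝ
  | true => 1
  | false => -1

/-! ### Wires as affine functions of the LP variables -/

/-- The `y`-coefficients of a wire: `0` for an input wire, the unit vector `e_m` for the gate
wire `m < L` (and `0` for a dangling reference, impossible in a well-formed program). [folklore] -/
def wc (L : ℕ) : ι ⊕ ℕ → (Fin L → ℝ)
  | .inl _ => 0
  | .inr m => if h : m < L then Pi.single ⟨m, h⟩ 1 else 0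

/-- The input coefficients of a wire: the unit vector `e_i` for the input wire `i`, `0` for a
gate wire. [folklore] -/
def wi [DecidableEq ι] : ι ⊕ ℕ → (ι → ℝ)
  | .inl i => Pi.single i 1
  | .inr _ => 0

/-- The real value carried by a wire under the input `x` and CLAIMED real gate values `y`.
[folklore] -/
def rwire (x : ι → Bool) {L : ℕ} (y : Fin L → ℝ) : ι ⊕ ℕ → ℝ
  | .inl i => b2r (x i)
  | .inr m => if h : m < L then y ⟨m, h⟩ else 0

/-- A wire is an affine function of `(y, ξ(x))`: `value(w) = wc w ⬝ᵥ y + wi w ⬝ᵥ ξ(x)`.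
[folklore] -/
theorem rwire_eq [Fintype ι] [DecidableEq ι] (x : ι → Bool) {L : ℕ} (y : Fin L → ℝ)
    (w : ι ⊕ ℕ) : rwire x y w = wc L w ⬝ᵥ y + wi w ⬝ᵥ ξ x := by
  cases w with
  | inl i => simp [rwire, wc, wi]
  | inr m =>
    by_cases h : m < L
    · simp [rwire, wc, wi, h]
    · simp [rwire, wc, wi, h]

/-- The corner gap of gate `g` at corner `α`: `∑_a lit (α a) (value of argument a)`. [folklore] -/
def gap (x : ι → Bool) {L : ℕ} (y : Fin L → ℝ) (g : Gate ι) (α : Fin g.arity → Bool) : ℝ :=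
  ∑ a, lit (α a) (rwire x y (g.args a))

/-! ### The constraint system of a gate list with an output wire -/

/-- Constraint indices of the LP of the program `gs`: a corner `(j, α)` of gate `j`; the lower
box constraint `y_j ≥ 0`; the upper box constraint `y_j ≤ 1`; the output constraint. [folklore] -/
abbrev Idx (gs : List (Gate ι)) : Type _ :=
  ((j : Fin gs.length) × (Fin (gs.get j).arity → Bool)) ⊕ Fin gs.length ⊕ Fin gs.length ⊕ Unit

/-- `y`-coefficients of the constraints. [folklore] -/
def cvec (gs : List (Gate ι)) (out : ι ⊕ ℕ) : Idx gs → (Fin gs.length → ℝ)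
  | .inl ⟨j, α⟩ => sgn ((gs.get j).op α) • Pi.single j 1 +
      ∑ a, lsign (α a) • wc gs.length ((gs.get j).args a)
  | .inr (.inl j) => Pi.single j 1
  | .inr (.inr (.inl j)) => -Pi.single j 1
  | .inr (.inr (.inr _)) => wc gs.length out

/-- Input coefficients of the constraints. [folklore] -/
def ivec [DecidableEq ι] (gs : List (Gate ι)) (out : ι ⊕ ℕ) : Idx gs → (ι → ℝ)
  | .inl ⟨j, α⟩ => ∑ a, lsign (α a) • wi ((gs.get j).args a)
  | .inr (.inl _) => 0
  | .inr (.inr (.inl _)) => 0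
  | .inr (.inr (.inr _)) => wi out

/-- Constant terms of the constraints. [folklore] -/
def k0 (gs : List (Gate ι)) : Idx gs → ℝ
  | .inl ⟨j, α⟩ => ∑ a, loff (α a) - b2r ((gs.get j).op α)
  | .inr (.inl _) => 0
  | .inr (.inr (.inl _)) => 1
  | .inr (.inr (.inr _)) => -1

/-- The slack of constraint `g` at `(x, y)`: `cvec g ⬝ᵥ y + ivec g ⬝ᵥ ξ(x) + k0 g`; the LP of the
program is `∀ g, 0 ≤ slack g`. [folklore] -/
def slack [Fintype ι] [DecidableEq ι] (gs : List (Gate ι)) (out : ι ⊕ ℕ) (x : ι → Bool)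
    (y : Fin gs.length → ℝ) (g : Idx gs) : ℝ :=
  cvec gs out g ⬝ᵥ y + ivec gs out g ⬝ᵥ ξ x + k0 gs g

section Slack

variable [Fintype ι] [DecidableEq ι] (gs : List (Gate ι)) (out : ι ⊕ ℕ) (x : ι → Bool)
  (y : Fin gs.length → ℝ)

/-- The corner constraint `(j, α)` reads `sgn · y_j + gap_α - [op α] ≥ 0`, i.e. `y_j ≥ 1 - gap_α`
if `op α = 1` and `y_j ≤ gap_α` if `op α = 0`. [folklore] -/
theorem slack_corner (j : Fin gs.length) (α : Fin (gs.get j).arity → Bool) :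
    slack gs out x y (.inl ⟨j, α⟩) =
      sgn ((gs.get j).op α) * y j + gap x y (gs.get j) α - b2r ((gs.get j).op α) := by
  simp only [slack, cvec, ivec, k0, gap, add_dotProduct, smul_dotProduct, single_dotProduct,
    one_mul, smul_eq_mul, sum_dotProduct, lit_eq, rwire_eq x y, Finset.sum_add_distrib,
    mul_add]
  ring

/-- The lower box constraint reads `y_j ≥ 0`. [folklore] -/
theorem slack_lower (j : Fin gs.length) : slack gs out x y (.inr (.inl j)) = y j := by
  simp [slack, cvec, ivec, k0]

/-- The upper box constraint reads `1 - y_j ≥ 0`. [folklore] -/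
theorem slack_upper (j : Fin gs.length) : slack gs out x y (.inr (.inr (.inl j))) = 1 - y j := by
  simp [slack, cvec, ivec, k0]
  ring

/-- The output constraint reads `value(out) - 1 ≥ 0`. [folklore] -/
theorem slack_out (u : Unit) : slack gs out x y (.inr (.inr (.inr u))) = rwire x y out - 1 := by
  simp only [slack, cvec, ivec, k0, rwire_eq x y]
  ring

end Slack

/-! ### True gate values -/

/-- The true value of gate `j` on input `x`, as a real number. [folklore] -/
def trueVal (gs : List (Gate ι)) (x : ι → Bool) (j : Fin gs.length) : ℝ :=
  b2r ((vals gs x).getD j false)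

/-- Under the true gate values every wire carries (the real number of) its true bit. [folklore] -/
theorem rwire_trueVal (gs : List (Gate ι)) (x : ι → Bool) (w : ι ⊕ ℕ)
    (hw : ∀ m, w = .inr m → m < gs.length) :
    rwire x (trueVal gs x) w = b2r (wireOf x (vals gs x) w) := by
  cases w with
  | inl i => rfl
  | inr m =>
    have hm : m < gs.length := hw m rfl
    simp [rwire, hm, trueVal]

/-- The recorded value of gate `j` is its truth table applied to the bits on its argument wires
(`GateList.vals_consistent`, restated with `List.get`). [folklore] -/
theorem getD_vals_eq (gs : List (Gate ι)) (hwf : WF gs) (x : ι → Bool) (j : Fin gs.length) :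
    (vals gs x).getD j false = (gs.get j).op fun a => wireOf x (vals gs x) ((gs.get j).args a) := by
  have hj : gs[(j : ℕ)]? = some (gs.get j) := by simp
  have h := vals_consistent gs hwf x j (gs.get j) hj
  rw [List.getD_eq_getElem?_getD, h, Option.getD_some]

/-- **Local exactness at one gate.** If the claimed values `y` give every argument wire of gate
`j` its true bit, then the corner constraints of gate `j` together with `0 ≤ y_j ≤ 1` force
`y_j` to be the true value of gate `j`. [cite: Hrubes2020, Prop. 7(i)] -/
theorem eq_trueVal_of_args (gs : List (Gate ι)) (hwf : WF gs) (x : ι → Bool)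
    (y : Fin gs.length → ℝ) (j : Fin gs.length)
    (hargs : ∀ a, rwire x y ((gs.get j).args a) = b2r (wireOf x (vals gs x) ((gs.get j).args a)))
    (h0 : 0 ≤ y j) (h1 : y j ≤ 1)
    (hcor : ∀ α : Fin (gs.get j).arity → Bool,
      0 ≤ sgn ((gs.get j).op α) * y j + gap x y (gs.get j) α - b2r ((gs.get j).op α)) :
    y j = trueVal gs x j := by
  set β : Fin (gs.get j).arity → Bool := fun a => wireOf x (vals gs x) ((gs.get j).args a) with hβ
  have hgap : gap x y (gs.get j) β = 0 := by
    unfold gap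
    exact Finset.sum_eq_zero fun a _ => by rw [hargs a, hβ]; exact lit_self _
  have hval : trueVal gs x j = b2r ((gs.get j).op β) := by
    rw [trueVal, getD_vals_eq gs hwf x j]
  have hc := hcor β
  rw [hgap] at hc
  rw [hval]
  cases hop : (gs.get j).op β
  · simp only [hop, sgn, b2r_false] at hc ⊢
    linarith
  · simp only [hop, sgn, b2r_true] at hc ⊢
    linarith

/-- **Exactness of the circuit LP on Boolean inputs.** For a well-formed program and a Boolean
input `x`, every real `y` with `0 ≤ y ≤ 1` satisfying all corner constraints is the vector of
true gate values. (Induction along the program: the arguments of gate `j` are inputs or gates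
`m < j`.) [cite: Hrubes2020, Prop. 7(i)] -/
theorem eq_trueVal_of_feasible (gs : List (Gate ι)) (hwf : WF gs) (x : ι → Bool)
    (y : Fin gs.length → ℝ) (hbox : ∀ j, 0 ≤ y j ∧ y j ≤ 1)
    (hcor : ∀ (j : Fin gs.length) (α : Fin (gs.get j).arity → Bool),
      0 ≤ sgn ((gs.get j).op α) * y j + gap x y (gs.get j) α - b2r ((gs.get j).op α)) :
    ∀ j, y j = trueVal gs x j := by
  suffices key : ∀ n : ℕ, ∀ j : Fin gs.length, (j : ℕ) = n → y j = trueVal gs x j from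
    fun j => key j j rfl
  intro n
  induction n using Nat.strong_induction_on with
  | _ n ih =>
    intro j hjn
    refine eq_trueVal_of_args gs hwf x y j (fun a => ?_) (hbox j).1 (hbox j).2 (hcor j)
    -- every argument wire already carries its true bit
    rcases hw : (gs.get j).args a with i | m
    · rfl
    · have hmj : m < (j : ℕ) := hwf j (gs.get j) (by simp) a m hw
      have hmL : m < gs.length := hmj.trans j.2
      have him := ih m (hjn ▸ hmj) ⟨m, hmL⟩ rfl
      simp only [rwire, hmL, ↓reduceDIte, wireOf_inr, him, trueVal]

/-- Under an exact solution every valid wire carries its true bit. [folklore] -/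
theorem rwire_eq_of_eq_trueVal (gs : List (Gate ι)) (x : ι → Bool) (y : Fin gs.length → ℝ)
    (hy : ∀ j, y j = trueVal gs x j) (w : ι ⊕ ℕ) (hw : ∀ m, w = .inr m → m < gs.length) :
    rwire x y w = b2r (wireOf x (vals gs x) w) := by
  have : y = trueVal gs x := funext hy
  subst this
  exact rwire_trueVal gs x w hw

/-- **Feasibility of the true values (gate constraints).** The true gate values satisfy every
corner constraint: at the presented corner with equality up to the truth value, at any other
corner because the gap is `≥ 1`. [cite: Hrubes2020, Prop. 7(i)] -/
theorem corner_trueVal_nonneg (gs : List (Gate ι)) (hwf : WF gs) (x : ι → Bool)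
    (j : Fin gs.length) (α : Fin (gs.get j).arity → Bool) :
    0 ≤ sgn ((gs.get j).op α) * trueVal gs x j + gap x (trueVal gs x) (gs.get j) α -
      b2r ((gs.get j).op α) := by
  set β : Fin (gs.get j).arity → Bool := fun a => wireOf x (vals gs x) ((gs.get j).args a) with hβ
  have hargs : ∀ a, rwire x (trueVal gs x) ((gs.get j).args a) = b2r (β a) := fun a =>
    rwire_trueVal gs x _ fun m hm => (hwf j (gs.get j) (by simp) a m hm).trans j.2
  have hval : trueVal gs x j = b2r ((gs.get j).op β) := by
    rw [trueVal, getD_vals_eq gs hwf x j]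
  by_cases hαβ : α = β
  · subst hαβ
    have hgap : gap x (trueVal gs x) (gs.get j) β = 0 := by
      unfold gap
      exact Finset.sum_eq_zero fun a _ => by rw [hargs a]; exact lit_self _
    rw [hgap, hval]
    cases (gs.get j).op β
    · simp only [sgn, b2r_false]; norm_num
    · simp only [sgn, b2r_true]; norm_num
  · -- some argument position presents the opposite bit: the gap is at least one
    obtain ⟨a, ha⟩ : ∃ a, α a ≠ β a := by
      by_contra h
      push Not at h
      exact hαβ (funext h)
    have hgap : 1 ≤ gap x (trueVal gs x) (gs.get j) α := by
      unfold gap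
      calc (1 : ℝ) = lit (α a) (rwire x (trueVal gs x) ((gs.get j).args a)) := by
            rw [hargs a, lit_of_ne ha]
        _ ≤ ∑ a', lit (α a') (rwire x (trueVal gs x) ((gs.get j).args a')) :=
            Finset.single_le_sum (f := fun a' => lit (α a') (rwire x (trueVal gs x)
              ((gs.get j).args a'))) (fun a' _ => by
                rw [hargs a']; exact lit_nonneg _ (b2r_nonneg _) (b2r_le_one _))
              (Finset.mem_univ a)
    have h0 : 0 ≤ trueVal gs x j := b2r_nonneg _
    have h1 : trueVal gs x j ≤ 1 := b2r_le_one _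
    cases (gs.get j).op α
    · simp only [sgn, b2r_false]; linarith
    · simp only [sgn, b2r_true]; linarith

/-- **Feasibility of the true values (all but the output constraint).** [cite: Hrubes2020, Prop. 7(i)] -/
theorem slack_trueVal_nonneg [Fintype ι] [DecidableEq ι] (gs : List (Gate ι)) (hwf : WF gs)
    (out : ι ⊕ ℕ) (x : ι → Bool) (g : Idx gs) (hg : ∀ u, g ≠ .inr (.inr (.inr u))) :
    0 ≤ slack gs out x (trueVal gs x) g := by
  rcases g with ⟨j, α⟩ | j | j | u
  · rw [slack_corner]; exact corner_trueVal_nonneg gs hwf x j α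
  · rw [slack_lower]; exact b2r_nonneg _
  · rw [slack_upper, sub_nonneg]; exact b2r_le_one _
  · exact absurd rfl (hg u)

/-- The output slack under the true values is `b2r (output bit) - 1`. [folklore] -/
theorem slack_out_trueVal [Fintype ι] [DecidableEq ι] (gs : List (Gate ι)) (out : ι ⊕ ℕ)
    (hout : ∀ m, out = .inr m → m < gs.length) (x : ι → Bool) (u : Unit) :
    slack gs out x (trueVal gs x) (.inr (.inr (.inr u))) = b2r (wireOf x (vals gs x) out) - 1 := by
  rw [slack_out, rwire_trueVal gs x out hout]

/-- **Infeasibility on rejecting inputs.** If the whole system (corners, box, output `≥ 1`) has a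
real solution over the Boolean input `x`, then the program outputs `1` on `x`. [cite: Hrubes2020, Prop. 7(i)] -/
theorem wireOf_eq_true_of_feasible [Fintype ι] [DecidableEq ι] (gs : List (Gate ι)) (hwf : WF gs)
    (out : ι ⊕ ℕ) (hout : ∀ m, out = .inr m → m < gs.length) (x : ι → Bool)
    (y : Fin gs.length → ℝ) (hy : ∀ g, 0 ≤ slack gs out x y g) :
    wireOf x (vals gs x) out = true := by
  have hbox : ∀ j, 0 ≤ y j ∧ y j ≤ 1 := fun j =>
    ⟨by simpa [slack_lower] using hy (.inr (.inl j)),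
     by have := hy (.inr (.inr (.inl j))); rw [slack_upper] at this; linarith⟩
  have hcor : ∀ (j : Fin gs.length) (α : Fin (gs.get j).arity → Bool),
      0 ≤ sgn ((gs.get j).op α) * y j + gap x y (gs.get j) α - b2r ((gs.get j).op α) :=
    fun j α => by simpa [slack_corner] using hy (.inl ⟨j, α⟩)
  have hex := eq_trueVal_of_feasible gs hwf x y hbox hcor
  have hout' := hy (.inr (.inr (.inr ())))
  rw [slack_out, rwire_eq_of_eq_trueVal gs x y hex out hout] at hout'
  cases h : wireOf x (vals gs x) out
  · rw [h, b2r_false] at hout'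
    linarith
  · rfl

/-! ### Counting the constraints -/

/-- The number of constraints: `∑_j 2^{arity j} + 2L + 1`. [folklore] -/
theorem card_idx (gs : List (Gate ι)) :
    Fintype.card (Idx gs) = ∑ j : Fin gs.length, 2 ^ (gs.get j).arity + 2 * gs.length + 1 := by
  simp only [Idx, Fintype.card_sum, Fintype.card_sigma, Fintype.card_fun, Fintype.card_bool,
    Fintype.card_fin, Fintype.card_unit]
  ring

/-- Over the binary basis `B2` (fan-in `≤ 2`) there are at most `6L + 1` constraints. [folklore] -/
theorem card_idx_le (gs : List (Gate ι)) (hB : ∀ g ∈ gs, g.fn ∈ B2) :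
    Fintype.card (Idx gs) ≤ 6 * gs.length + 1 := by
  rw [card_idx]
  have h : ∑ j : Fin gs.length, 2 ^ (gs.get j).arity ≤ ∑ _j : Fin gs.length, 4 :=
    Finset.sum_le_sum fun j _ => by
      have hj : (gs.get j).arity ≤ 2 := hB (gs.get j) (List.get_mem gs j)
      calc 2 ^ (gs.get j).arity ≤ 2 ^ 2 := Nat.pow_le_pow_right (by norm_num) hj
        _ = 4 := by norm_num
  simp only [Finset.sum_const, Finset.card_univ, Fintype.card_fin, smul_eq_mul] at h
  omega

end CircuitLP

end Literature.Computability.Complexity
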